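/-
Copyright: cell pub-balaban-gaps (YM BLITZ Y1, track G1), seat g1-p2 GEN 4 (unit `pub-balaban-gaps-g1-p2`).  Row (D4) NODE O,
OBJECT ∕ MECHANISM level: the positivity input `hpos : (1 + H₀).PosDef` of the full model term (`Gaps/D4WalkModelFull`) DISCHARGED
from the Neumann-type row-sum smallness of the real symmetric reference direction `H₀` (Schur's bound) — g1-plan-1 L-4 «`hC`
carries the Neumann smallness at u = 0 too».  HONEST FRAMING: elementary linear algebra; nothing of Bałaban's; (D4) NOT
discharged (instance 0∕1); NOT BetaPertH, NOT continuum, NOT Clay.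
-/
import Mathlib

/-!
# `Gaps.D4WalkPosDef` — `1 + H` is positive definite when the absolute row sums of the real symmetric `H` are `< 1`
# (cell pub-balaban-gaps, seat g1-p2 gen 4)

HONEST DEPENDENCY (cell pub-balaban, verbatim): continuum YM on T⁴ ⇐ BetaPertH ∧ nine spine estimates (0/9 proved);
BetaPertH ⇐ (D1) ∧ (D4) ∧ CAP+tail.

`abs_dotProduct_mulVec_le` — SCHUR'S BOUND for a real quadratic form: absolute row sums and column sums of `H` bounded by `θ`
⟹ `|x ⬝ᵥ (H x)| ≤ θ·(x ⬝ᵥ x)` (AM–GM termwise, then the two marginal sums).  `posDef_one_add` — `H` symmetric with absolute row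
sums `≤ θ < 1` ⟹ `(1 + H).PosDef` (`Matrix.PosDef.of_dotProduct_mulVec_pos`).  This is the form in which the reference precision
`1 + H₀` of `Gaps/D4WalkModelFull.FullModelTerm.toKernels` is positive from the SAME smallness that sums the Neumann series
([B9] p. 422 *"each operator Δ′_π provides the small factor"*; [II] p. 15 *"for (U, 0) the operators are symmetric, and the
measure is positive"*).  Value: elementary; nothing of Bałaban's asserted; words of row (D4) UNCHANGED.
-/

namespace Summit.QuantumFields.BalabanUV.Gaps.D4WalkPosDef

open Finset Matrix

variable {Λ : Type} [Fintype Λ]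

/-- AM–GM for one term of the quadratic form: `|xᵢ H xⱼ| ≤ |H|·(xᵢ² + xⱼ²)∕2`. -/
theorem abs_term_le (a h b : ℝ) : |a * h * b| ≤ |h| * (a ^ 2 / 2) + |h| * (b ^ 2 / 2) := by
  rw [abs_mul, abs_mul]
  have h2 : |a| * |b| ≤ a ^ 2 / 2 + b ^ 2 / 2 := by
    nlinarith [sq_nonneg (|a| - |b|), sq_abs a, sq_abs b]
  calc |a| * |h| * |b| = |h| * (|a| * |b|) := by ring
    _ ≤ |h| * (a ^ 2 / 2 + b ^ 2 / 2) := mul_le_mul_of_nonneg_left h2 (abs_nonneg _)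
    _ = |h| * (a ^ 2 / 2) + |h| * (b ^ 2 / 2) := by ring

/-- **SCHUR'S BOUND** for a real quadratic form: if every absolute row sum and every absolute column sum of `H` is `≤ θ`, then
`|x ⬝ᵥ (H *ᵥ x)| ≤ θ·(x ⬝ᵥ x)`. -/
theorem abs_dotProduct_mulVec_le (H : Matrix Λ Λ ℝ) {θ : ℝ} (hrow : ∀ i, ∑ j, |H i j| ≤ θ)
    (hcol : ∀ j, ∑ i, |H i j| ≤ θ) (x : Λ → ℝ) :
    |x ⬝ᵥ (H *ᵥ x)| ≤ θ * (x ⬝ᵥ x) := by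
  have e : x ⬝ᵥ (H *ᵥ x) = ∑ i, ∑ j, x i * H i j * x j := by
    simp only [dotProduct, Matrix.mulVec, Finset.mul_sum]
    exact Finset.sum_congr rfl fun i _ => Finset.sum_congr rfl fun j _ => by ring
  have exx : x ⬝ᵥ x = ∑ i, x i ^ 2 := by
    simp only [dotProduct]
    exact Finset.sum_congr rfl fun i _ => by ring
  rw [e, exx]
  calc |∑ i, ∑ j, x i * H i j * x j|
      ≤ ∑ i, |∑ j, x i * H i j * x j| := Finset.abs_sum_le_sum_abs _ _
    _ ≤ ∑ i, ∑ j, |x i * H i j * x j| := Finset.sum_le_sum fun i _ => Finset.abs_sum_le_sum_abs _ _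
    _ ≤ ∑ i, ∑ j, (|H i j| * (x i ^ 2 / 2) + |H i j| * (x j ^ 2 / 2)) :=
        Finset.sum_le_sum fun i _ => Finset.sum_le_sum fun j _ => abs_term_le (x i) (H i j) (x j)
    _ = ∑ i, ∑ j, |H i j| * (x i ^ 2 / 2) + ∑ i, ∑ j, |H i j| * (x j ^ 2 / 2) := by
        rw [← Finset.sum_add_distrib]
        exact Finset.sum_congr rfl fun i _ => Finset.sum_add_distrib
    _ = ∑ i, (∑ j, |H i j|) * (x i ^ 2 / 2) + ∑ j, (∑ i, |H i j|) * (x j ^ 2 / 2) := by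
        have hc : ∑ i, ∑ j, |H i j| * (x j ^ 2 / 2) = ∑ j, ∑ i, |H i j| * (x j ^ 2 / 2) := Finset.sum_comm
        rw [hc]
        congr 1
        · exact Finset.sum_congr rfl fun i _ => (Finset.sum_mul _ _ _).symm
        · exact Finset.sum_congr rfl fun j _ => (Finset.sum_mul _ _ _).symm
    _ ≤ ∑ i, θ * (x i ^ 2 / 2) + ∑ j, θ * (x j ^ 2 / 2) :=
        add_le_add (Finset.sum_le_sum fun i _ => mul_le_mul_of_nonneg_right (hrow i) (by positivity))
          (Finset.sum_le_sum fun j _ => mul_le_mul_of_nonneg_right (hcol j) (by positivity))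
    _ = θ * ∑ i, x i ^ 2 := by
        rw [← Finset.mul_sum, ← Finset.sum_div]; ring

/-- **`1 + H` IS POSITIVE DEFINITE** for a real SYMMETRIC `H` whose absolute row sums are `≤ θ < 1` (the columns by symmetry):
`x ⬝ᵥ ((1 + H)x) ≥ (1 − θ)‖x‖² > 0` for `x ≠ 0`. -/
theorem posDef_one_add [DecidableEq Λ] (H : Matrix Λ Λ ℝ) (hsymm : H.IsSymm) {θ : ℝ} (hθ : θ < 1)
    (hrow : ∀ i, ∑ j, |H i j| ≤ θ) : ((1 : Matrix Λ Λ ℝ) + H).PosDef := by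
  have hcol : ∀ j, ∑ i, |H i j| ≤ θ := fun j =>
    (Finset.sum_congr rfl fun i _ => by rw [hsymm.apply i j]).trans_le (hrow j)
  refine Matrix.PosDef.of_dotProduct_mulVec_pos ?_ fun x hx => ?_
  · rw [Matrix.isHermitian_iff_isSymm]
    show ((1 : Matrix Λ Λ ℝ) + H)ᵀ = 1 + H
    rw [Matrix.transpose_add, Matrix.transpose_one, hsymm.eq]
  · have hxx : 0 < x ⬝ᵥ x := by
      rcases (dotProduct_star_self_nonneg x).lt_or_eq with h | h
      · simpa using h
      · exact absurd (dotProduct_self_eq_zero.1 (by simpa using h.symm)) hx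
    have hb := abs_le.1 (abs_dotProduct_mulVec_le H hrow hcol x)
    simp only [star_trivial, Matrix.add_mulVec, Matrix.one_mulVec, dotProduct_add]
    nlinarith [hb.1, hxx, hθ]

end Summit.QuantumFields.BalabanUV.Gaps.D4WalkPosDef
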